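import Summits.AtomisticToContinuum.Crystallization.Theorems.ReggeStarCoercivityDefectFreeCrystallizesLayeredGluing10

/-!
# Part 11 of the proof of `stub_layeredGluing : LayeredGluing` (S5a, line `prestress-split-korn`, crux stmt-AtomisticToContinuum-13603); see the module docstring of the final part `ReggeStarCoercivityDefectFreeCrystallizesLayeredGluing.lean` for the overview
-/

noncomputable section

open scoped BigOperators Classical InnerProductSpace
open Filter Topology

namespace Summit.AtomisticToContinuum.Crystallization.Theorems.PrestressSplitKorn

open Summit.AtomisticToContinuum.Crystallization.Theses
open Summit.AtomisticToContinuum.Crystallization.Theses.ReggeStarCoercivity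
open Summit.AtomisticToContinuum.Crystallization.Theorems.DefectFreeCrystallizes.Negative.PredicateAPI
open Literature.MathematicalPhysics.StatisticalMechanics Literature.Geometry.DiscreteGeometry


section Sites

variable {a : ℝ} {s : ℤ → ℤ} {z : ℤ → ℝ}

section Slab

variable {a : ℝ} {s : ℤ → ℤ} {z : ℤ → ℝ} {Y : Set (EuclideanSpace ℝ (Fin 3))}

/-- Auxiliary step `InBox.z_neg_two` of the proof of `stub_layeredGluing` (S5a); see the final part's module docstring. -/
theorem InBox.z_neg_two (h : InBox a z) (hz0 : z 0 = 0) : 39 / 25 * a ≤ -z (-2) ∧ -z (-2) ≤ 17 / 10 * a := by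
  have hz1 := h.z_neg_one hz0
  have hz12 := h.2.2 (-2)
  rw [show (-2 : ℤ) + 1 = -1 by norm_num] at hz12
  constructor <;> linarith [hz1.1, hz1.2, hz12.1, hz12.2]

/-- A site of layer `±2` with small horizontal form is in the open 2-ball. -/
theorem norm_far_site_lt (h : InBox a z) (hz0 : z 0 = 0) {m : ℤ} (hm : m = 2 ∨ m = -2) (i j : ℤ)
    (hQ : (i : ℝ) ^ 2 + i * j + (j : ℝ) ^ 2 + (haggLabel s m : ℝ) * (i + j) + (haggLabel s m : ℝ) ^ 2 / 3 ≤ 1) :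
    ‖layeredPos a s z (m, i, j)‖ < 2 := by
  apply norm_lt_two_of_sq
  rw [norm_sq_layeredPos]
  have ha := h.a_pos
  have ha1 := h.2.1
  have hzm : z m ^ 2 ≤ (17 / 10 * a) ^ 2 := by
    rcases hm with rfl | rfl
    · have := h.z_two hz0; nlinarith [this.1, this.2]
    · have := h.z_neg_two hz0; nlinarith [this.1, this.2]
  have hQ0 : 0 ≤ (i : ℝ) ^ 2 + i * j + (j : ℝ) ^ 2 + (haggLabel s m : ℝ) * (i + j) + (haggLabel s m : ℝ) ^ 2 / 3 := by
    nlinarith [sq_nonneg ((i : ℝ) + j / 2 + haggLabel s m / 2), sq_nonneg ((j : ℝ) + haggLabel s m / 3)]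
  nlinarith

/-- Shifting a site within its layer. -/
theorem layeredPos_sub_planar (m i j i₁ j₁ : ℤ) :
    layeredPos a s z (m, i, j) - ((i₁ : ℝ) • triangularVec₁ a + (j₁ : ℝ) • triangularVec₂ a) =
      layeredPos a s z (m, i - i₁, j - j₁) := by
  simp only [layeredPos]; push_cast; module

/-- **Step 3'.** Neighbouring identity-framed templates with the same first layers have the same
second layers. -/
theorem framed_data_eq₂ {p e : EuclideanSpace ℝ (Fin 3)} {i₁ j₁ : ℤ} (hij : (i₁, j₁) = (0, 0) ∨ (i₁, j₁) = (1, 0) ∨ (i₁, j₁) = (0, 1))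
    (he : e = (i₁ : ℝ) • triangularVec₁ a + (j₁ : ℝ) • triangularVec₂ a)
    {s' : ℤ → ℤ} {z' : ℤ → ℝ} (hp : FramedAt a Y p s z) (hq : FramedAt a Y (p + e) s' z')
    (h1 : s' 0 = s 0 ∧ s' (-1) = s (-1)) :
    z' 2 = z 2 ∧ s' 1 = s 1 ∧ z' (-2) = z (-2) ∧ s' (-2) = s (-2) := by
  obtain ⟨hbox, hs, hz0, -, hp2⟩ := hp
  obtain ⟨hbox', hs', hz0', hq1, -⟩ := hq
  have ha := hbox.a_pos
  have h3 : (0 : ℝ) < √3 := by positivity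
  have he1 : e 1 = a * √3 / 2 * j₁ := by rw [he]; simp [triangularVec₁, triangularVec₂]; ring
  have he2 : e 2 = 0 := by rw [he]; simp [triangularVec₁, triangularVec₂]
  -- generic reading of a far witness
  have read : ∀ m : ℤ, (m = 2 ∨ m = -2) → ∀ i₀ j₀ : ℤ,
      ‖layeredPos a s z (m, i₀, j₀)‖ < 2 → ‖layeredPos a s z (m, i₀ - i₁, j₀ - j₁)‖ < 2 →
      ∃ l : ℤ × ℤ × ℤ, z' l.1 = z m ∧ (3 : ℤ) ∣ (haggLabel s m - haggLabel s' l.1) := by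
    intro m hm i₀ j₀ hn0 hn1
    have htY : p + layeredPos a s z (m, i₀, j₀) ∈ Y := hp2 _ hn0
    have hdist : dist (p + layeredPos a s z (m, i₀, j₀)) (p + e) < 2 := by
      rw [dist_eq_norm, show p + layeredPos a s z (m, i₀, j₀) - (p + e) = layeredPos a s z (m, i₀, j₀) - e by abel,
        he, layeredPos_sub_planar]
      exact hn1
    obtain ⟨l, hl⟩ := hq1 _ htY hdist
    refine ⟨l, ?_, ?_⟩
    · have := congrArg (fun x : EuclideanSpace ℝ (Fin 3) => x 2) hl
      simp only [PiLp.add_apply, layeredPos_apply_two, he2] at this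
      linarith
    · have := congrArg (fun x : EuclideanSpace ℝ (Fin 3) => x 1) hl
      simp only [PiLp.add_apply, layeredPos_apply_one, he1] at this
      have hne : a * √3 / 2 ≠ 0 := by positivity
      have e3 : (j₀ : ℝ) + haggLabel s m / 3 = j₁ + (l.2.2 + haggLabel s' l.1 / 3) := by
        have : a * √3 / 2 * ((j₀ : ℝ) + haggLabel s m / 3) = a * √3 / 2 * (j₁ + (l.2.2 + haggLabel s' l.1 / 3)) := by
          linarith
        exact mul_left_cancel₀ hne this
      have hint : 3 * j₀ + haggLabel s m = 3 * j₁ + 3 * l.2.2 + haggLabel s' l.1 := by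
        have : ((3 * j₀ + haggLabel s m : ℤ) : ℝ) = ((3 * j₁ + 3 * l.2.2 + haggLabel s' l.1 : ℤ) : ℝ) := by
          push_cast; linarith
        exact_mod_cast this
      exact ⟨j₁ + l.2.2 - j₀, by linarith⟩
  have hL2 : (haggLabel s 2 : ℝ) = s 0 + s 1 := by rw [haggLabel_two]; push_cast; ring
  have hLm2 : (haggLabel s (-2) : ℝ) = -s (-1) - s (-2) := by rw [haggLabel_neg_two]; push_cast; ring
  -- layer `2`
  have hup : z' 2 = z 2 ∧ s' 1 = s 1 := by
    obtain ⟨i₀, j₀, hn0, hn1⟩ : ∃ i₀ j₀ : ℤ, ‖layeredPos a s z (2, i₀, j₀)‖ < 2 ∧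
        ‖layeredPos a s z (2, i₀ - i₁, j₀ - j₁)‖ < 2 := by
      rcases hs 0 with h0 | h0 <;> rcases hs 1 with h1' | h1' <;>
        rcases hij with h | h | h <;> simp only [Prod.mk.injEq] at h <;> obtain ⟨rfl, rfl⟩ := h
      · exact ⟨0, -1, norm_far_site_lt hbox hz0 (Or.inl rfl) _ _ (by rw [hL2, h0, h1']; push_cast; norm_num),
          norm_far_site_lt hbox hz0 (Or.inl rfl) _ _ (by rw [hL2, h0, h1']; push_cast; norm_num)⟩
      · exact ⟨0, -1, norm_far_site_lt hbox hz0 (Or.inl rfl) _ _ (by rw [hL2, h0, h1']; push_cast; norm_num),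
          norm_far_site_lt hbox hz0 (Or.inl rfl) _ _ (by rw [hL2, h0, h1']; push_cast; norm_num)⟩
      · exact ⟨-1, 0, norm_far_site_lt hbox hz0 (Or.inl rfl) _ _ (by rw [hL2, h0, h1']; push_cast; norm_num),
          norm_far_site_lt hbox hz0 (Or.inl rfl) _ _ (by rw [hL2, h0, h1']; push_cast; norm_num)⟩
      · exact ⟨0, 0, norm_far_site_lt hbox hz0 (Or.inl rfl) _ _ (by rw [hL2, h0, h1']; push_cast; norm_num),
          norm_far_site_lt hbox hz0 (Or.inl rfl) _ _ (by rw [hL2, h0, h1']; push_cast; norm_num)⟩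
      · exact ⟨0, 0, norm_far_site_lt hbox hz0 (Or.inl rfl) _ _ (by rw [hL2, h0, h1']; push_cast; norm_num),
          norm_far_site_lt hbox hz0 (Or.inl rfl) _ _ (by rw [hL2, h0, h1']; push_cast; norm_num)⟩
      · exact ⟨0, 0, norm_far_site_lt hbox hz0 (Or.inl rfl) _ _ (by rw [hL2, h0, h1']; push_cast; norm_num),
          norm_far_site_lt hbox hz0 (Or.inl rfl) _ _ (by rw [hL2, h0, h1']; push_cast; norm_num)⟩
      · exact ⟨0, 0, norm_far_site_lt hbox hz0 (Or.inl rfl) _ _ (by rw [hL2, h0, h1']; push_cast; norm_num),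
          norm_far_site_lt hbox hz0 (Or.inl rfl) _ _ (by rw [hL2, h0, h1']; push_cast; norm_num)⟩
      · exact ⟨0, 0, norm_far_site_lt hbox hz0 (Or.inl rfl) _ _ (by rw [hL2, h0, h1']; push_cast; norm_num),
          norm_far_site_lt hbox hz0 (Or.inl rfl) _ _ (by rw [hL2, h0, h1']; push_cast; norm_num)⟩
      · exact ⟨0, 0, norm_far_site_lt hbox hz0 (Or.inl rfl) _ _ (by rw [hL2, h0, h1']; push_cast; norm_num),
          norm_far_site_lt hbox hz0 (Or.inl rfl) _ _ (by rw [hL2, h0, h1']; push_cast; norm_num)⟩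
      · exact ⟨1, 1, norm_far_site_lt hbox hz0 (Or.inl rfl) _ _ (by rw [hL2, h0, h1']; push_cast; norm_num),
          norm_far_site_lt hbox hz0 (Or.inl rfl) _ _ (by rw [hL2, h0, h1']; push_cast; norm_num)⟩
      · exact ⟨1, 1, norm_far_site_lt hbox hz0 (Or.inl rfl) _ _ (by rw [hL2, h0, h1']; push_cast; norm_num),
          norm_far_site_lt hbox hz0 (Or.inl rfl) _ _ (by rw [hL2, h0, h1']; push_cast; norm_num)⟩
      · exact ⟨1, 1, norm_far_site_lt hbox hz0 (Or.inl rfl) _ _ (by rw [hL2, h0, h1']; push_cast; norm_num),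
          norm_far_site_lt hbox hz0 (Or.inl rfl) _ _ (by rw [hL2, h0, h1']; push_cast; norm_num)⟩
    obtain ⟨l, hzl, hdvd⟩ := read 2 (Or.inl rfl) i₀ j₀ hn0 hn1
    have hl2 : l.1 = 2 := hbox'.eq_two_of_z_mem hz0' (by rw [hzl]; exact hbox.z_two hz0)
    rw [hl2] at hzl hdvd
    refine ⟨hzl, ?_⟩
    rw [haggLabel_two, haggLabel_two, h1.1] at hdvd
    rcases hs 1 with h | h <;> rcases hs' 1 with h' | h' <;> omega
  -- layer `-2`
  have hdn : z' (-2) = z (-2) ∧ s' (-2) = s (-2) := by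
    obtain ⟨i₀, j₀, hn0, hn1⟩ : ∃ i₀ j₀ : ℤ, ‖layeredPos a s z (-2, i₀, j₀)‖ < 2 ∧
        ‖layeredPos a s z (-2, i₀ - i₁, j₀ - j₁)‖ < 2 := by
      rcases hs (-1) with h0 | h0 <;> rcases hs (-2) with h1' | h1' <;>
        rcases hij with h | h | h <;> simp only [Prod.mk.injEq] at h <;> obtain ⟨rfl, rfl⟩ := h
      · exact ⟨1, 1, norm_far_site_lt hbox hz0 (Or.inr rfl) _ _ (by rw [hLm2, h0, h1']; push_cast; norm_num),
          norm_far_site_lt hbox hz0 (Or.inr rfl) _ _ (by rw [hLm2, h0, h1']; push_cast; norm_num)⟩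
      · exact ⟨1, 1, norm_far_site_lt hbox hz0 (Or.inr rfl) _ _ (by rw [hLm2, h0, h1']; push_cast; norm_num),
          norm_far_site_lt hbox hz0 (Or.inr rfl) _ _ (by rw [hLm2, h0, h1']; push_cast; norm_num)⟩
      · exact ⟨1, 1, norm_far_site_lt hbox hz0 (Or.inr rfl) _ _ (by rw [hLm2, h0, h1']; push_cast; norm_num),
          norm_far_site_lt hbox hz0 (Or.inr rfl) _ _ (by rw [hLm2, h0, h1']; push_cast; norm_num)⟩
      · exact ⟨0, 0, norm_far_site_lt hbox hz0 (Or.inr rfl) _ _ (by rw [hLm2, h0, h1']; push_cast; norm_num),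
          norm_far_site_lt hbox hz0 (Or.inr rfl) _ _ (by rw [hLm2, h0, h1']; push_cast; norm_num)⟩
      · exact ⟨0, 0, norm_far_site_lt hbox hz0 (Or.inr rfl) _ _ (by rw [hLm2, h0, h1']; push_cast; norm_num),
          norm_far_site_lt hbox hz0 (Or.inr rfl) _ _ (by rw [hLm2, h0, h1']; push_cast; norm_num)⟩
      · exact ⟨0, 0, norm_far_site_lt hbox hz0 (Or.inr rfl) _ _ (by rw [hLm2, h0, h1']; push_cast; norm_num),
          norm_far_site_lt hbox hz0 (Or.inr rfl) _ _ (by rw [hLm2, h0, h1']; push_cast; norm_num)⟩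
      · exact ⟨0, 0, norm_far_site_lt hbox hz0 (Or.inr rfl) _ _ (by rw [hLm2, h0, h1']; push_cast; norm_num),
          norm_far_site_lt hbox hz0 (Or.inr rfl) _ _ (by rw [hLm2, h0, h1']; push_cast; norm_num)⟩
      · exact ⟨0, 0, norm_far_site_lt hbox hz0 (Or.inr rfl) _ _ (by rw [hLm2, h0, h1']; push_cast; norm_num),
          norm_far_site_lt hbox hz0 (Or.inr rfl) _ _ (by rw [hLm2, h0, h1']; push_cast; norm_num)⟩
      · exact ⟨0, 0, norm_far_site_lt hbox hz0 (Or.inr rfl) _ _ (by rw [hLm2, h0, h1']; push_cast; norm_num),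
          norm_far_site_lt hbox hz0 (Or.inr rfl) _ _ (by rw [hLm2, h0, h1']; push_cast; norm_num)⟩
      · exact ⟨0, -1, norm_far_site_lt hbox hz0 (Or.inr rfl) _ _ (by rw [hLm2, h0, h1']; push_cast; norm_num),
          norm_far_site_lt hbox hz0 (Or.inr rfl) _ _ (by rw [hLm2, h0, h1']; push_cast; norm_num)⟩
      · exact ⟨0, -1, norm_far_site_lt hbox hz0 (Or.inr rfl) _ _ (by rw [hLm2, h0, h1']; push_cast; norm_num),
          norm_far_site_lt hbox hz0 (Or.inr rfl) _ _ (by rw [hLm2, h0, h1']; push_cast; norm_num)⟩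
      · exact ⟨-1, 0, norm_far_site_lt hbox hz0 (Or.inr rfl) _ _ (by rw [hLm2, h0, h1']; push_cast; norm_num),
          norm_far_site_lt hbox hz0 (Or.inr rfl) _ _ (by rw [hLm2, h0, h1']; push_cast; norm_num)⟩
    obtain ⟨l, hzl, hdvd⟩ := read (-2) (Or.inr rfl) i₀ j₀ hn0 hn1
    have hl2 : l.1 = -2 := hbox'.eq_neg_two_of_z_mem hz0' (by rw [hzl]; exact hbox.z_neg_two hz0)
    rw [hl2] at hzl hdvd
    refine ⟨hzl, ?_⟩
    rw [haggLabel_neg_two, haggLabel_neg_two, h1.2] at hdvd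
    rcases hs (-2) with h | h <;> rcases hs' (-2) with h' | h' <;> omega
  exact ⟨hup.1, hup.2, hdn.1, hdn.2⟩

/-- Layer-`±2` data are constant along a framed layer. -/
theorem layer_data_const₂ {p : EuclideanSpace ℝ (Fin 3)} (hL : LayerFramed a Y p) (hp : FramedAt a Y p s z) (i j : ℤ)
    {s' : ℤ → ℤ} {z' : ℤ → ℝ}
    (hq : FramedAt a Y (p + ((i : ℝ) • triangularVec₁ a + (j : ℝ) • triangularVec₂ a)) s' z') :
    z' 2 = z 2 ∧ s' 1 = s 1 ∧ z' (-2) = z (-2) ∧ s' (-2) = s (-2) := by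
  -- first-layer data at any lattice point agree with those at `p`
  have d1 : ∀ (i j : ℤ) {s' : ℤ → ℤ} {z' : ℤ → ℝ},
      FramedAt a Y (p + ((i : ℝ) • triangularVec₁ a + (j : ℝ) • triangularVec₂ a)) s' z' →
      s' 0 = s 0 ∧ s' (-1) = s (-1) := fun i j s' z' h =>
    ⟨(layer_data_const hL hp i j h).2.1, (layer_data_const hL hp i j h).2.2.2⟩
  -- one step `x → x + e`
  have step : ∀ (i j i₁ j₁ : ℤ), ((i₁, j₁) = (0, 0) ∨ (i₁, j₁) = (1, 0) ∨ (i₁, j₁) = (0, 1)) →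
      ∀ {s₁ : ℤ → ℤ} {z₁ : ℤ → ℝ} {s₂ : ℤ → ℤ} {z₂ : ℤ → ℝ},
      FramedAt a Y (p + ((i : ℝ) • triangularVec₁ a + (j : ℝ) • triangularVec₂ a)) s₁ z₁ →
      FramedAt a Y (p + (((i + i₁ : ℤ) : ℝ) • triangularVec₁ a + ((j + j₁ : ℤ) : ℝ) • triangularVec₂ a)) s₂ z₂ →
      (z₂ 2 = z₁ 2 ∧ s₂ 1 = s₁ 1 ∧ z₂ (-2) = z₁ (-2) ∧ s₂ (-2) = s₁ (-2)) := by
    intro i j i₁ j₁ hij s₁ z₁ s₂ z₂ h₁ h₂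
    have e : p + (((i + i₁ : ℤ) : ℝ) • triangularVec₁ a + ((j + j₁ : ℤ) : ℝ) • triangularVec₂ a) =
        p + ((i : ℝ) • triangularVec₁ a + (j : ℝ) • triangularVec₂ a) +
          ((i₁ : ℝ) • triangularVec₁ a + (j₁ : ℝ) • triangularVec₂ a) := by push_cast; module
    have d₁ := d1 i j h₁
    have d₂ := d1 (i + i₁) (j + j₁) h₂
    rw [e] at h₂
    exact framed_data_eq₂ hij rfl h₁ h₂ ⟨d₂.1.trans d₁.1.symm, d₂.2.trans d₁.2.symm⟩
  -- induction along `u`, then along `v`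
  have hp0 : FramedAt a Y (p + (((0 : ℤ) : ℝ) • triangularVec₁ a + ((0 : ℤ) : ℝ) • triangularVec₂ a)) s z := by
    simpa using hp
  have hi : ∀ i : ℤ, ∀ {s' : ℤ → ℤ} {z' : ℤ → ℝ},
      FramedAt a Y (p + ((i : ℝ) • triangularVec₁ a + ((0 : ℤ) : ℝ) • triangularVec₂ a)) s' z' →
        z' 2 = z 2 ∧ s' 1 = s 1 ∧ z' (-2) = z (-2) ∧ s' (-2) = s (-2) := by
    intro i
    induction i using Int.induction_on with
    | zero => intro s' z' h; exact step 0 0 0 0 (Or.inl rfl) hp0 (by simpa using h)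
    | succ n ih =>
      intro s' z' h
      obtain ⟨s'', z'', h''⟩ := hL n 0
      have k := step n 0 1 0 (Or.inr (Or.inl rfl)) h'' (by simpa using h)
      have k' := ih h''
      exact ⟨k.1.trans k'.1, k.2.1.trans k'.2.1, k.2.2.1.trans k'.2.2.1, k.2.2.2.trans k'.2.2.2⟩
    | pred n ih =>
      intro s' z' h
      obtain ⟨s'', z'', h''⟩ := hL (-(n : ℤ)) 0
      have k := step (-(n : ℤ) - 1) 0 1 0 (Or.inr (Or.inl rfl)) h (by simpa using h'')
      have k' := ih h''
      exact ⟨k.1.symm.trans k'.1, k.2.1.symm.trans k'.2.1, k.2.2.1.symm.trans k'.2.2.1,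
        k.2.2.2.symm.trans k'.2.2.2⟩
  obtain ⟨s₁, z₁, h₁⟩ := hL i 0
  have hd₁ := hi i h₁
  have hj : ∀ j : ℤ, ∀ {s' : ℤ → ℤ} {z' : ℤ → ℝ},
      FramedAt a Y (p + ((i : ℝ) • triangularVec₁ a + (j : ℝ) • triangularVec₂ a)) s' z' →
        z' 2 = z₁ 2 ∧ s' 1 = s₁ 1 ∧ z' (-2) = z₁ (-2) ∧ s' (-2) = s₁ (-2) := by
    intro j
    induction j using Int.induction_on with
    | zero => intro s' z' h; exact step i 0 0 0 (Or.inl rfl) h₁ (by simpa using h)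
    | succ n ih =>
      intro s' z' h
      obtain ⟨s'', z'', h''⟩ := hL i n
      have k := step i n 0 1 (Or.inr (Or.inr rfl)) h'' (by simpa using h)
      have k' := ih h''
      exact ⟨k.1.trans k'.1, k.2.1.trans k'.2.1, k.2.2.1.trans k'.2.2.1, k.2.2.2.trans k'.2.2.2⟩
    | pred n ih =>
      intro s' z' h
      obtain ⟨s'', z'', h''⟩ := hL i (-(n : ℤ))
      have k := step i (-(n : ℤ) - 1) 0 1 (Or.inr (Or.inr rfl)) h (by simpa using h'')
      have k' := ih h''
      exact ⟨k.1.symm.trans k'.1, k.2.1.symm.trans k'.2.1, k.2.2.1.symm.trans k'.2.2.1,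
        k.2.2.2.symm.trans k'.2.2.2⟩
  have h2 := hj j hq
  exact ⟨h2.1.trans hd₁.1, h2.2.1.trans hd₁.2.1, h2.2.2.1.trans hd₁.2.2.1, h2.2.2.2.trans hd₁.2.2.2⟩

/-- Two templates with the same data on layers `-2 … 2` have the same sites there. -/
theorem layeredPos_congr₂ {s' : ℤ → ℤ} {z' : ℤ → ℝ} (hz0 : z 0 = 0) (hz0' : z' 0 = 0)
    (h1 : z' 1 = z 1 ∧ s' 0 = s 0 ∧ z' (-1) = z (-1) ∧ s' (-1) = s (-1))
    (h2 : z' 2 = z 2 ∧ s' 1 = s 1 ∧ z' (-2) = z (-2) ∧ s' (-2) = s (-2))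
    {l : ℤ × ℤ × ℤ} (hl : -2 ≤ l.1 ∧ l.1 ≤ 2) : layeredPos a s' z' l = layeredPos a s z l := by
  obtain ⟨m, i, j⟩ := l
  obtain ⟨hm1, hm2⟩ := hl
  simp only at hm1 hm2
  have hL : haggLabel s' m = haggLabel s m ∧ z' m = z m := by
    rcases (show m = -2 ∨ m = -1 ∨ m = 0 ∨ m = 1 ∨ m = 2 by omega) with rfl | rfl | rfl | rfl | rfl
    · exact ⟨by rw [haggLabel_neg_two, haggLabel_neg_two, h1.2.2.2, h2.2.2.2], h2.2.2.1⟩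
    · exact ⟨by rw [haggLabel_neg_one, haggLabel_neg_one, h1.2.2.2], h1.2.2.1⟩
    · exact ⟨by rw [haggLabel_zero, haggLabel_zero], by rw [hz0, hz0']⟩
    · exact ⟨by rw [haggLabel_one, haggLabel_one, h1.2.1], h1.1⟩
    · exact ⟨by rw [haggLabel_two, haggLabel_two, h1.2.1, h2.2.1], h2.1⟩
  simp only [layeredPos, hL.1, hL.2]

/-- A near witness in each of the five central layers. -/
theorem exists_near_witness (hbox : InBox a z) (hs : IsHaggSeq s) (hz0 : z 0 = 0) {m : ℤ}
    (hm : -2 ≤ m ∧ m ≤ 2) : ∃ i₀ j₀ : ℤ, ‖layeredPos a s z (m, i₀, j₀)‖ < 2 := by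
  have hL2 : (haggLabel s 2 : ℝ) = s 0 + s 1 := by rw [haggLabel_two]; push_cast; ring
  have hLm2 : (haggLabel s (-2) : ℝ) = -s (-1) - s (-2) := by rw [haggLabel_neg_two]; push_cast; ring
  rcases (show m = -2 ∨ m = -1 ∨ m = 0 ∨ m = 1 ∨ m = 2 by omega) with rfl | rfl | rfl | rfl | rfl
  · rcases hs (-1) with h0 | h0 <;> rcases hs (-2) with h1' | h1'
    · exact ⟨1, 1, norm_far_site_lt hbox hz0 (Or.inr rfl) _ _ (by rw [hLm2, h0, h1']; push_cast; norm_num)⟩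
    · exact ⟨0, 0, norm_far_site_lt hbox hz0 (Or.inr rfl) _ _ (by rw [hLm2, h0, h1']; push_cast; norm_num)⟩
    · exact ⟨0, 0, norm_far_site_lt hbox hz0 (Or.inr rfl) _ _ (by rw [hLm2, h0, h1']; push_cast; norm_num)⟩
    · exact ⟨0, -1, norm_far_site_lt hbox hz0 (Or.inr rfl) _ _ (by rw [hLm2, h0, h1']; push_cast; norm_num)⟩
  · exact ⟨0, 0, by rw [layeredPos_neg_one]; exact hbox.norm_down_lt hz0 hs⟩
  · exact ⟨0, 0, by rw [layeredPos_origin hz0, norm_zero]; norm_num⟩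
  · exact ⟨0, 0, by rw [layeredPos_one]; exact hbox.norm_up_lt hz0 hs⟩
  · rcases hs 0 with h0 | h0 <;> rcases hs 1 with h1' | h1'
    · exact ⟨0, -1, norm_far_site_lt hbox hz0 (Or.inl rfl) _ _ (by rw [hL2, h0, h1']; push_cast; norm_num)⟩
    · exact ⟨0, 0, norm_far_site_lt hbox hz0 (Or.inl rfl) _ _ (by rw [hL2, h0, h1']; push_cast; norm_num)⟩
    · exact ⟨0, 0, norm_far_site_lt hbox hz0 (Or.inl rfl) _ _ (by rw [hL2, h0, h1']; push_cast; norm_num)⟩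
    · exact ⟨1, 1, norm_far_site_lt hbox hz0 (Or.inl rfl) _ _ (by rw [hL2, h0, h1']; push_cast; norm_num)⟩

/-- **Slab membership.** All sites of the five central layers of the template at `p` are in `Y`
(full planes), provided the layer of `p` is framed. -/
theorem slab_mem {p : EuclideanSpace ℝ (Fin 3)} (hL : LayerFramed a Y p) (hp : FramedAt a Y p s z) {l : ℤ × ℤ × ℤ}
    (hl : -2 ≤ l.1 ∧ l.1 ≤ 2) : p + layeredPos a s z l ∈ Y := by
  obtain ⟨m, i, j⟩ := l
  obtain ⟨i₀, j₀, hw⟩ := exists_near_witness hp.1 hp.2.1 hp.2.2.1 hl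
  obtain ⟨s', z', hx⟩ := hL (i - i₀) (j - j₀)
  have h1 := layer_data_const hL hp _ _ hx
  have h2 := layer_data_const₂ hL hp _ _ hx
  have hsite : layeredPos a s' z' (m, i₀, j₀) = layeredPos a s z (m, i₀, j₀) :=
    layeredPos_congr₂ hp.2.2.1 hx.2.2.1 h1 h2 hl
  have := hx.2.2.2.2 (m, i₀, j₀) (by rw [hsite]; exact hw)
  rw [hsite] at this
  convert this using 1
  rw [add_assoc, add_right_inj, ← sub_eq_iff_eq_add', layeredPos_sub_planar]
  congr 2; simp

/-- **Slab exactness.** A point of `Y` less than `7/4` above or below the layer of `p` is a site of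
one of the five central layers. -/
theorem slab_exact {p : EuclideanSpace ℝ (Fin 3)} (hL : LayerFramed a Y p) (hp : FramedAt a Y p s z) {y : EuclideanSpace ℝ (Fin 3)} (hy : y ∈ Y)
    (hh : |y 2 - p 2| < 7 / 4) : ∃ l : ℤ × ℤ × ℤ, (-2 ≤ l.1 ∧ l.1 ≤ 2) ∧ y = p + layeredPos a s z l := by
  have hbox := hp.1
  have hz0 := hp.2.2.1
  have ha := hbox.a_pos
  have ha1 := hbox.2.1
  set d : EuclideanSpace ℝ (Fin 3) := y - p - (y 2 - p 2) • layerNormal 1 with hd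
  have hd2 : d 2 = 0 := by simp [hd, layerNormal]
  obtain ⟨i, j, hij⟩ := exists_planar_near ha d hd2
  set q : EuclideanSpace ℝ (Fin 3) := p + ((i : ℝ) • triangularVec₁ a + (j : ℝ) • triangularVec₂ a) with hq
  obtain ⟨s', z', hq'⟩ := hL i j
  have h1 := layer_data_const hL hp i j hq'
  have h2 := layer_data_const₂ hL hp i j hq'
  have hdist : ‖y - q‖ ^ 2 = ‖d - ((i : ℝ) • triangularVec₁ a + (j : ℝ) • triangularVec₂ a)‖ ^ 2 +
      (y 2 - p 2) ^ 2 := by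
    rw [norm_sq_fin3, norm_sq_fin3]
    simp [hq, hd, layerNormal, triangularVec₁, triangularVec₂]
    ring
  have hyq : dist y q < 2 := by
    rw [dist_eq_norm]
    apply norm_lt_two_of_sq
    rw [hdist]
    have : (y 2 - p 2) ^ 2 < (7 / 4) ^ 2 := by
      have := sq_lt_sq' (abs_lt.1 hh).1 (abs_lt.1 hh).2
      simpa using this
    nlinarith [hij]
  rw [hq] at hyq
  obtain ⟨l, hl⟩ := hq'.2.2.2.1 y hy hyq
  have hzl : z' l.1 = y 2 - p 2 := by
    have := congrArg (fun x : EuclideanSpace ℝ (Fin 3) => x 2) hl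
    simp only [PiLp.add_apply, PiLp.smul_apply, smul_eq_mul, layeredPos_apply_two] at this
    have hu : (triangularVec₁ a) 2 = 0 := by simp [triangularVec₁]
    have hv : (triangularVec₂ a) 2 = 0 := by simp [triangularVec₂]
    rw [hu, hv] at this
    linarith
  have hl2 : -2 ≤ l.1 ∧ l.1 ≤ 2 := by
    have habs : |z' l.1| < 7 / 4 := by rw [hzl]; exact hh
    have := (hq'.1.abs_z_le hq'.2.2.1 l.1).2
    have h3 : |(l.1 : ℝ)| < 3 := by linarith
    rw [← Int.cast_abs] at h3
    have : |l.1| < 3 := by exact_mod_cast h3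
    rw [abs_lt] at this; omega
  refine ⟨l + (0, i, j), by simpa using hl2, ?_⟩
  rw [hl, layeredPos_congr₂ hz0 hq'.2.2.1 h1 h2 hl2, add_assoc, add_right_inj]
  obtain ⟨m, i', j'⟩ := l
  simp only [Prod.mk_add_mk, add_zero, layeredPos]
  push_cast; module

/-- Landing anchor of this file (registered stub of crux stmt-AtomisticToContinuum-13603; re-exports a result above). -/
theorem layeredGluing_part11_anchor :
    ∀ (a : ℝ) (z : ℤ → ℝ), InBox a z → z 0 = 0 → 39 / 25 * a ≤ -z (-2) ∧ -z (-2) ≤ 17 / 10 * a :=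
  fun _ _ h h0 => h.z_neg_two h0

end Slab
end Sites

end Summit.AtomisticToContinuum.Crystallization.Theorems.PrestressSplitKorn
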